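import Summits.BirchSwinnertonDyer.BirchSwinnertonDyer.Theses.CountingDoorF2AtThree
import Summits.BirchSwinnertonDyer.BirchSwinnertonDyer.Theorems.CountingDoorF2AtThreeCountingBridge
import Summits.BirchSwinnertonDyer.Rank2.F2DensityAlgebra
import HarnessLib

/-!
# BirchSwinnertonDyer / CountingDoorF2AtThree — support item `CountingBridgeLoc`
# (stmt-BirchSwinnertonDyer-19683, rev 11): PROVED — the localized counting bridge

Route `route-BirchSwinnertonDyer-CountingDoorF2AtThree` (cell bsd-rank2; TWIN-axis leaf T-r2
`PAdicBSDRankTwoPositiveProportion`; re-glue I4 → I4loc, director-bsd GO 2026-08-26T13:01:20Z,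
planner p2 GEN 11, memo `HOME/p2/PADIC-R2-G11.md` §1). The support item says: the published inputs at
`3` (`PublishedInputsAtThree`), the large-family facts (`LargeFamilyInputsF2`), generic members
(I0 `GenericMembersLargeF2`), the `3`-Selmer average (I1 `SelmerThreeAverageLargeF2`), root number
`+1` with lower density `> 1/6` (I2 `RootNumberPlusLowerDensityLargeF2`) and the LOCALIZED Schneider
crux I4loc (`SchneiderOnDoorSubfamily`: ONE large `Φ` with nonempty local conditions, the local
door conditions member-wise, and Schneider at `3` for a density-one set of rank-two members) imply
the leaf. Proof = the parametric kernel `Theorems.leaf_of_local` (eng GEN 4, p436628) fed with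
I4loc's `Φ`: `hGen` from I0 (monotonicity of `100 %` properties, `hasDensityOn_one_mono`), `hA` = I1
at `Φ`, `hW`, `ρ > 1/6` from I2 at `Φ`, threshold `36 < 27 + 54ρ`. PARTITION: none — r_an ≥ 2,
summit axis S0; TWIN (D-0056): n/a. B1 honesty: modus-ponens glue over the landed kernel; no analytic
rank, no `L`-value; no S0 motion.
-/

set_option linter.dupNamespace false

noncomputable section

open scoped Classical
open Filter Topology
open WeierstrassCurve Literature.NumberTheory.EllipticCurves
  Literature.NumberTheory.EllipticCurves.BhargavaHo2022
  Summit.BirchSwinnertonDyer.Rank2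
  Summit.BirchSwinnertonDyer.BirchSwinnertonDyer.Theses.CountingDoorF2AtThree

namespace Summit.BirchSwinnertonDyer.BirchSwinnertonDyer.Theorems

/-- **`CountingBridgeLoc` holds** (stmt-BirchSwinnertonDyer-19683): the published inputs at `3`,
the large-family facts, generic members, I1, I2 and I4loc imply the leaf
`PAdicBSDRankTwoPositiveProportion` — `leaf_of_local` applied to I4loc's family `Φ` with `A = 36`
(I1) and `ρ > 1/6` (I2), so that `36 < 27 + 54ρ`. [cite: BhargavaHo2022, Thm. 1.3 (shape: positive proportion); BhargavaShankarTernary2015, §1 (first-moment method with parity)] -/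
theorem countingBridgeLoc :
    Summit.BirchSwinnertonDyer.BirchSwinnertonDyer.Theses.CountingDoorF2AtThree.CountingBridgeLoc := by
  intro hIn hL h0 h1 h2 h4
  obtain ⟨Φ, hΦ, hne, hloc, hSchD⟩ := h4
  have hGen : Φ.HasDensityOn (fun a ↦ 2 ≤ a.curve.mordellWeilRank) 1 :=
    hasDensityOn_one_mono Φ (h0 hL Φ hΦ hne) fun _ h ↦ h.2
  obtain ⟨ρ, hρ6, hW⟩ := h2 Φ hΦ hne
  exact leaf_of_local Φ hΦ hloc hIn hGen (h1 Φ hΦ) hW (by linarith) (by linarith) hSchD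

end Summit.BirchSwinnertonDyer.BirchSwinnertonDyer.Theorems

end
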